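import Literature.Probability.RandomPlanarGeometry.SLERealFlowGenerator
import Literature.Analysis.FunctionSpaces.ItoMartingale
import Literature.Analysis.Calculus.SmoothIntervalExtension
import Literature.Probability.Process.MartingaleLimit
import HarnessLib

/-!
# Lawler's one-point martingales for the real SLE_κ flow: the Itô steps proved

Topic `Probability/RandomPlanarGeometry`; theorems only. Discharge of the two named facts of
`SLEOnePointMartingale` — the Itô steps of Lawler (2005), §1.10, proof of Prop. 1.21 (with §6.2,
eq. (6.3) / Prop. 6.8 for the transfer to chordal SLE_κ):

* `Literature.Probability.RandomPlanarGeometry.sle_martingale_onePointPow_holds`: for `κ > 4` and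
  `0 ≤ x₁ < x < x₂`, the stopped power `(X_{t∧σ})^{1-4/κ}` of the frozen real SLE_κ flow
  (`σ` the exit time of `(x₁, x₂)`) is a martingale of the raw Brownian filtration;
* `Literature.Probability.RandomPlanarGeometry.sle_martingale_onePointSq_holds`: for
  `0 ≤ x₁ < x < x₂`, `(X_{t∧σ})² - (4+κ)(t∧σ)` is a martingale.

Together with `SLEOnePointSwallowingProofs` (a.s. swallowing of real points for `κ > 4` from these
two martingales) this leaves Lawler's two-point martingale as the only remaining input of
Cardy's formula for SLE₆ in the tree (`CritPerc.sle_six_measureReal_hitsBefore_of_itoSteps`).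

## Proof

For `0 < x₁` (the case printed by Lawler: "Itô's formula shows that `M_t := φ₀(X_{t∧σ})` is a
bounded martingale"): Lawler's `σ = lowerTime ⊓ levelTime` is the exit time of the frozen flow
`X = sleRealFlowStop κ x` from `(x₁, x₂)` (`sleExitTime_eq_exitTime`, a stopping time of the raw
filtration by `Literature.Probability.Process.isStoppingTime_exitTime`); the stopped flow `V = X^σ`
takes values in `[x₁, x₂] ⊂ (0, ∞)` and is an Itô process `dV = 𝟙_{s≤σ}(2/V) ds + 𝟙_{s≤σ}(-√κ) dB`
(`isItoProcess_stoppedProcess_sleRealFlowStop`, file `SLERealFlowIto`). For a `C²` function `f` on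
`ℝ` equal to `u ↦ u^q`, `q = 1 - 4/κ`, near `[x₁, x₂]`
(`Literature.Analysis.Calculus.exists_contDiff_eqOn_Icc`) the Itô drift
`(2/v)·q v^{q-1} + (κ/2)·q(q-1) v^{q-2} = q v^{q-2}(2 + κ(q-1)/2)` vanishes identically, so
`f(V) = V^q` is a martingale (`Literature.Analysis.FunctionSpaces.martingale_apply_of_itoDrift_eq_zero`,
Itô's formula); for `u²` the drift is the truncated constant `4 + κ`, whose time integral is
`(4+κ)(t∧σ)` (`martingale_apply_sub_timeIntegral`). For `x₁ = 0` (Lawler's limit `x₁ → 0+`): the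
stopped clocks `t ∧ σₙ` of the levels `x/(n+2) ↓ 0` increase to `t ∧ σ₀` along every path
(`tendsto_untopA_min_exitTime`), so the observables converge pointwise, boundedly, and bounded
pointwise limits of martingales are martingales
(`Literature.Probability.Process.martingale_of_tendsto_of_abs_le'`).

## References

* G. F. Lawler, *Conformally Invariant Processes in the Plane*, AMS (2005), §1.10, Prop. 1.21 and
  the first paragraph of its proof; §6.2, eq. (6.3), Prop. 6.8.
* D. Revuz, M. Yor, *Continuous Martingales and Brownian Motion* (3rd ed., 1999), Ch. IV,
  Thm (3.3); Ch. XI, §1, Def. (1.1) (squared Bessel processes).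
-/

noncomputable section

open MeasureTheory Filter Topology Set
open scoped NNReal ENNReal

namespace Literature.Probability.RandomPlanarGeometry

open Loewner Literature.Probability.Process Literature.Analysis.FunctionSpaces
  Literature.Analysis.Calculus

variable {κ : ℝ≥0} {x x₁ x₂ : ℝ}

/-! ### Lawler's exit time `σ` as the exit time of the frozen flow from `(x₁, x₂)` -/

-- Lawler's exit time `sleExitTime κ x x₁ x₂` is the exit time
-- `Literature.Probability.Process.exitTime (sleRealFlowStop κ x) x₁ x₂` of `ContinuousHitting`:
-- `sleExitTime_eq_exitTime` of `SLERealFlowGenerator` (landed concurrently with this file).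

/-! ### The case `0 < x₁`: Itô's formula -/

section Pos

/-- Geometry of the stopped frozen flow (any `x₁ < x < x₂`, `x ≠ 0`): the frozen real SLE_κ flow
from `x`, stopped at its exit time from `(x₁, x₂)`, stays in `[x₁, x₂]`. [folklore] -/
theorem stoppedProcess_sleRealFlowStop_exitTime_mem_Icc (hx : x ≠ 0) (h₁ : x₁ < x) (h₂ : x < x₂)
    (t : ℝ≥0) (ω : ℝ≥0 → ℝ) :
    stoppedProcess (sleRealFlowStop κ x) (Process.exitTime (sleRealFlowStop κ x) x₁ x₂) t ω ∈
      Icc x₁ x₂ :=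
  Process.stoppedProcess_exitTime_mem_Icc (continuous_sleRealFlowStop hx ω)
    (by rw [sleRealFlowStop_zero_apply hx]; exact ⟨h₁, h₂⟩) t

/-- **Lawler's power martingale for `0 < x₁`** (the printed case of Prop. 1.21: "Itô's formula
shows that `M_t := φ₀(X_{t∧σ})` is a bounded martingale", `φ₀` affine in `u^{1-2a}`,
`σ = inf{t : X_t ∈ {x₁, x₂}}`, `0 < x₁ < x < x₂`): for `κ > 4` the process
`(X_{t∧σ})^{1-4/κ}` is a martingale. Proof: the stopped frozen flow `V = X^σ` is an Itô process
with drift `𝟙_{s≤σ} 2/V` and diffusion `𝟙_{s≤σ}(-√κ)` (`isItoProcess_stoppedProcess_sleRealFlowStop`),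
with values in `[x₁, x₂] ⊂ (0, ∞)`; along it, for a `C²` function `f` equal to `u ↦ u^q`,
`q = 1 - 4/κ`, near `[x₁, x₂]` (`exists_contDiff_eqOn_Icc`), the Itô drift
`(2/v) q v^{q-1} + (κ/2) q(q-1) v^{q-2} = q v^{q-2}(2 + κ(q-1)/2)` vanishes, so `f(V) = V^q` is a
martingale (`martingale_apply_of_itoDrift_eq_zero`). [cite: Lawler2005, Prop. 1.21] -/
theorem martingale_sleOnePointPow_of_pos (hκ : 4 < κ) (hx₁ : 0 < x₁) (h₁ : x₁ < x) (h₂ : x < x₂) :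
    Martingale (sleOnePointPow κ x x₁ x₂) brownianFiltration Process.preWienerMeasure := by
  have hx : x ≠ 0 := (hx₁.trans h₁).ne'
  have hκ0 : (0 : ℝ) < κ := lt_trans (by norm_num) (show (4 : ℝ) < κ by exact_mod_cast hκ)
  set q : ℝ := 1 - 4 / (κ : ℝ) with hqdef
  set X := sleRealFlowStop κ x with hXdef
  have hXc : ∀ ω, Continuous fun t ↦ X t ω := continuous_sleRealFlowStop hx
  have hXa : Adapted brownianFiltration X := adapted_sleRealFlowStop κ hx
  set ρ := Process.exitTime X x₁ x₂ with hρdef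
  have hρ : IsStoppingTime brownianFiltration ρ := Process.isStoppingTime_exitTime hXa hXc
  have hρ' : ∀ t : ℝ≥0, MeasurableSet[brownianFiltration t] {ω | ρ ω < t} :=
    fun t ↦ hρ.measurableSet_lt t
  set V := stoppedProcess X ρ with hVdef
  have hVmem : ∀ t ω, V t ω ∈ Icc x₁ x₂ := fun t ω ↦
    stoppedProcess_sleRealFlowStop_exitTime_mem_Icc hx h₁ h₂ t ω
  have hVpos : ∀ t ω, 0 < V t ω := fun t ω ↦ hx₁.trans_le (hVmem t ω).1
  have hρX : ∀ ω (t : ℝ≥0), (t : WithTop ℝ≥0) ≤ ρ ω → X t ω ≠ 0 := by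
    intro ω t ht
    have h := hVpos t ω
    rw [hVdef, stoppedProcess_eq_of_le ht] at h
    exact h.ne'
  have hV : IsItoProcess V (trunc ρ fun s ω ↦ 2 / V s ω) (trunc ρ fun _ _ ↦ -Real.sqrt κ)
      brownian brownianFiltration preWienerMeasure :=
    isItoProcess_stoppedProcess_sleRealFlowStop hx hρ hρX
  have hVa : StronglyAdapted brownianFiltration V :=
    Process.stronglyAdapted_stoppedProcess_exitTime hXa hXc
  have hVc : ∀ ω, Continuous (V · ω) := fun ω ↦ Process.continuous_stoppedProcess_path (hXc ω) ρ
  have hVprog : IsStronglyProgressive brownianFiltration V :=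
    hVa.isStronglyProgressive_of_continuous hVc
  have hb : IsStronglyProgressive brownianFiltration (trunc ρ fun s ω ↦ 2 / V s ω) :=
    isStronglyProgressive_trunc (IsStronglyProgressive.comp_measurable₂ hVprog
      (F := fun _ v ↦ 2 / v) (measurable_const.div measurable_snd)) hρ'
  have hσ : IsStronglyProgressive brownianFiltration
      (trunc ρ fun (_ : ℝ≥0) (_ : ℝ≥0 → ℝ) ↦ -Real.sqrt κ) :=
    isStronglyProgressive_trunc (isStronglyProgressive_const _ _) hρ'
  have hV0 : ∀ ω, V 0 ω = x := fun ω ↦ by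
    rw [hVdef, stoppedProcess_eq_of_le (coe_zero_le_withTop _)]
    exact sleRealFlowStop_zero_apply hx ω
  have hσbd : ∀ t ω, |trunc ρ (fun (_ : ℝ≥0) (_ : ℝ≥0 → ℝ) ↦ -Real.sqrt κ) t ω| ≤ Real.sqrt κ := by
    intro t ω
    rw [trunc_apply]
    split_ifs
    · rw [abs_neg, abs_of_nonneg (Real.sqrt_nonneg _)]
    · rw [abs_zero]; exact Real.sqrt_nonneg _
  -- a `C²` function equal to `u ↦ u^q` on `[x₁/2, 2x₂]`
  have hg : ContDiffOn ℝ 2 (fun u : ℝ ↦ u ^ q) (Ioo 0 (3 * x₂)) := fun u hu ↦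
    (Real.contDiffAt_rpow_const_of_ne hu.1.ne').contDiffWithinAt
  obtain ⟨f, hf, hfeq, -⟩ := exists_contDiff_eqOn_Icc (n := 2) (lo := x₁ / 2) (hi := 2 * x₂)
    (by linarith) (by linarith) (by linarith) hg
  have hx₂ : 0 < x₂ := hx₁.trans (h₁.trans h₂)
  -- derivatives of `f` on `[x₁, x₂]`
  have hfnhds : ∀ v ∈ Icc x₁ x₂, f =ᶠ[𝓝 v] fun u ↦ u ^ q := by
    intro v hv
    have hmem : Ioo (x₁ / 2) (2 * x₂) ∈ 𝓝 v := Ioo_mem_nhds (by linarith [hv.1]) (by linarith [hv.2])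
    filter_upwards [hmem] with u hu
    exact hfeq (Ioo_subset_Icc_self hu)
  have hd1 : ∀ v ∈ Icc x₁ x₂, deriv f v = q * v ^ (q - 1) := by
    intro v hv
    rw [(hfnhds v hv).deriv_eq]
    exact (Real.hasStrictDerivAt_rpow_const_of_ne (hx₁.trans_le hv.1).ne' q).hasDerivAt.deriv
  have hd2 : ∀ v ∈ Icc x₁ x₂, iteratedDeriv 2 f v = q * ((q - 1) * v ^ (q - 2)) := by
    intro v hv
    have hvpos : 0 < v := hx₁.trans_le hv.1
    rw [iteratedDeriv_succ, iteratedDeriv_one]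
    have h1 : deriv f =ᶠ[𝓝 v] fun u ↦ q * u ^ (q - 1) := by
      have hmem : Ioo (x₁ / 2) (2 * x₂) ∈ 𝓝 v :=
        Ioo_mem_nhds (by linarith [hv.1]) (by linarith [hv.2])
      filter_upwards [(hfnhds v hv).deriv, hmem] with u hu hu'
      rw [hu]
      exact (Real.hasStrictDerivAt_rpow_const_of_ne (by linarith [hu'.1] : u ≠ 0) q).hasDerivAt.deriv
    rw [h1.deriv_eq]
    have h2 := ((Real.hasStrictDerivAt_rpow_const_of_ne hvpos.ne' (q - 1)).hasDerivAt).const_mul q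
    rw [show q - 1 - 1 = q - 2 by ring] at h2
    exact h2.deriv
  -- the Itô drift of `f` along `V` vanishes
  have hdrift : ∀ s ω, trunc ρ (fun s ω ↦ 2 / V s ω) s ω * deriv f (V s ω) +
      2⁻¹ * trunc ρ (fun (_ : ℝ≥0) (_ : ℝ≥0 → ℝ) ↦ -Real.sqrt κ) s ω ^ 2 *
        iteratedDeriv 2 f (V s ω) = 0 := by
    intro s ω
    by_cases hs : (s : WithTop ℝ≥0) ≤ ρ ω
    · rw [trunc_of_le hs, trunc_of_le hs, hd1 _ (hVmem s ω), hd2 _ (hVmem s ω), neg_sq,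
        Real.sq_sqrt κ.coe_nonneg]
      have hv := hVpos s ω
      set v := V s ω with hv'
      have hrpow : v ^ (q - 1) = v ^ (q - 2) * v := by
        rw [show q - 1 = q - 2 + 1 by ring, Real.rpow_add_one hv.ne']
      rw [hrpow]
      have hκq : (κ : ℝ) * (q - 1) = -4 := by
        rw [hqdef]; field_simp; ring
      have : 2 / v * (q * (v ^ (q - 2) * v)) + 2⁻¹ * (κ : ℝ) * (q * ((q - 1) * v ^ (q - 2))) =
          q * v ^ (q - 2) * (2 + (κ : ℝ) * (q - 1) / 2) := by
        field_simp
      rw [this, hκq]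
      ring
    · rw [trunc_of_not_le hs, trunc_of_not_le hs]
      simp
  have hmart := martingale_apply_of_itoDrift_eq_zero hf hVa hVc hb hσ hV hV0 hVmem hσbd hdrift
  -- identify the observable
  have heq : sleOnePointPow κ x x₁ x₂ = fun t ω ↦ f (V t ω) := by
    funext t ω
    rw [sleOnePointPow, sleExitTime_eq_exitTime]
    have hmem := hVmem t ω
    rw [hfeq ⟨by linarith [hmem.1], by linarith [hmem.2]⟩]
  rw [heq]
  exact hmart

end Pos

/-! ### The quadratic observable for `0 < x₁` -/

section PosSq

/-- **The quadratic one-point martingale for `0 < x₁`**: for `0 < x₁ < x < x₂` (any `κ`), the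
process `(X_{t∧σ})² - (4+κ)(t∧σ)` is a martingale. Itô's formula for `u²` along the stopped frozen
flow `V = X^σ` (drift `𝟙_{s≤σ} 2/V`, diffusion `𝟙_{s≤σ}(-√κ)`): the Itô drift is
`(2/V)(2V) + ½κ·2 = 4 + κ` before `σ` and `0` after, whose time integral is `(4+κ)(t∧σ)`
(`martingale_apply_sub_timeIntegral`, `timeIntegral_trunc`). Revuz–Yor (1999), Ch. XI §1
(`X²/κ` is a squared Bessel process of dimension `1 + 4/κ`); Lawler (2005), eq. (6.3).
[cite: RevuzYor1999, Ch. XI §1 Def. (1.1)] -/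
theorem martingale_sleOnePointSq_of_pos (hx₁ : 0 < x₁) (h₁ : x₁ < x) (h₂ : x < x₂) :
    Martingale (sleOnePointSq κ x x₁ x₂) brownianFiltration Process.preWienerMeasure := by
  have hx : x ≠ 0 := (hx₁.trans h₁).ne'
  set X := sleRealFlowStop κ x with hXdef
  have hXc : ∀ ω, Continuous fun t ↦ X t ω := continuous_sleRealFlowStop hx
  have hXa : Adapted brownianFiltration X := adapted_sleRealFlowStop κ hx
  set ρ := Process.exitTime X x₁ x₂ with hρdef
  have hρ : IsStoppingTime brownianFiltration ρ := Process.isStoppingTime_exitTime hXa hXc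
  have hρ' : ∀ t : ℝ≥0, MeasurableSet[brownianFiltration t] {ω | ρ ω < t} :=
    fun t ↦ hρ.measurableSet_lt t
  set V := stoppedProcess X ρ with hVdef
  have hVmem : ∀ t ω, V t ω ∈ Icc x₁ x₂ := fun t ω ↦
    stoppedProcess_sleRealFlowStop_exitTime_mem_Icc hx h₁ h₂ t ω
  have hVpos : ∀ t ω, 0 < V t ω := fun t ω ↦ hx₁.trans_le (hVmem t ω).1
  have hρX : ∀ ω (t : ℝ≥0), (t : WithTop ℝ≥0) ≤ ρ ω → X t ω ≠ 0 := by
    intro ω t ht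
    have h := hVpos t ω
    rw [hVdef, stoppedProcess_eq_of_le ht] at h
    exact h.ne'
  have hV : IsItoProcess V (trunc ρ fun s ω ↦ 2 / V s ω) (trunc ρ fun _ _ ↦ -Real.sqrt κ)
      brownian brownianFiltration preWienerMeasure :=
    isItoProcess_stoppedProcess_sleRealFlowStop hx hρ hρX
  have hVa : StronglyAdapted brownianFiltration V :=
    Process.stronglyAdapted_stoppedProcess_exitTime hXa hXc
  have hVc : ∀ ω, Continuous (V · ω) := fun ω ↦ Process.continuous_stoppedProcess_path (hXc ω) ρ
  have hVprog : IsStronglyProgressive brownianFiltration V :=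
    hVa.isStronglyProgressive_of_continuous hVc
  have hb : IsStronglyProgressive brownianFiltration (trunc ρ fun s ω ↦ 2 / V s ω) :=
    isStronglyProgressive_trunc (IsStronglyProgressive.comp_measurable₂ hVprog
      (F := fun _ v ↦ 2 / v) (measurable_const.div measurable_snd)) hρ'
  have hσ : IsStronglyProgressive brownianFiltration
      (trunc ρ fun (_ : ℝ≥0) (_ : ℝ≥0 → ℝ) ↦ -Real.sqrt κ) :=
    isStronglyProgressive_trunc (isStronglyProgressive_const _ _) hρ'
  have hV0 : ∀ ω, V 0 ω = x := fun ω ↦ by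
    rw [hVdef, stoppedProcess_eq_of_le (coe_zero_le_withTop _)]
    exact sleRealFlowStop_zero_apply hx ω
  have hσbd : ∀ t ω, |trunc ρ (fun (_ : ℝ≥0) (_ : ℝ≥0 → ℝ) ↦ -Real.sqrt κ) t ω| ≤ Real.sqrt κ := by
    intro t ω
    rw [trunc_apply]
    split_ifs
    · rw [abs_neg, abs_of_nonneg (Real.sqrt_nonneg _)]
    · rw [abs_zero]; exact Real.sqrt_nonneg _
  have hf : ContDiff ℝ 2 (fun u : ℝ ↦ u ^ 2) := contDiff_id.pow 2
  have hd1 : ∀ v : ℝ, deriv (fun u : ℝ ↦ u ^ 2) v = 2 * v := by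
    intro v
    rw [(hasDerivAt_pow 2 v).deriv]
    simp [pow_one]
  have hd2 : ∀ v : ℝ, iteratedDeriv 2 (fun u : ℝ ↦ u ^ 2) v = 2 := by
    intro v
    rw [iteratedDeriv_succ, iteratedDeriv_one]
    have h1 : deriv (fun u : ℝ ↦ u ^ 2) = fun v ↦ 2 * v := funext hd1
    rw [h1, deriv_const_mul _ differentiableAt_id, deriv_id'', mul_one]
  have hmart := martingale_apply_sub_timeIntegral hf hVa hVc hb hσ hV hV0 hVmem hσbd
  -- the Itô drift is the truncated constant `4 + κ`
  have hdrift : (fun s ω ↦ trunc ρ (fun s ω ↦ 2 / V s ω) s ω * deriv (fun u : ℝ ↦ u ^ 2) (V s ω) +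
      2⁻¹ * trunc ρ (fun (_ : ℝ≥0) (_ : ℝ≥0 → ℝ) ↦ -Real.sqrt κ) s ω ^ 2 *
        iteratedDeriv 2 (fun u : ℝ ↦ u ^ 2) (V s ω)) =
      trunc ρ fun (_ : ℝ≥0) (_ : ℝ≥0 → ℝ) ↦ (4 + (κ : ℝ)) := by
    funext s ω
    rw [hd1, hd2]
    by_cases hs : (s : WithTop ℝ≥0) ≤ ρ ω
    · rw [trunc_of_le hs, trunc_of_le hs, trunc_of_le hs, neg_sq, Real.sq_sqrt κ.coe_nonneg]
      have hv := (hVpos s ω).ne'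
      field_simp
      ring
    · rw [trunc_of_not_le hs, trunc_of_not_le hs, trunc_of_not_le hs]
      simp
  rw [hdrift] at hmart
  -- the time integral of the truncated constant is `(4 + κ)(t ∧ σ)`
  have hint : ∀ t ω, timeIntegral (trunc ρ fun (_ : ℝ≥0) (_ : ℝ≥0 → ℝ) ↦ (4 + (κ : ℝ))) t ω =
      (4 + (κ : ℝ)) * ((min (t : WithTop ℝ≥0) (ρ ω)).untopA : ℝ≥0) := by
    intro t ω
    rw [timeIntegral_trunc]
    simp only [timeIntegral, intervalIntegral.integral_const, sub_zero, smul_eq_mul]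
    ring
  have heq : sleOnePointSq κ x x₁ x₂ = fun t ω ↦ (V t ω) ^ 2 -
      timeIntegral (trunc ρ fun (_ : ℝ≥0) (_ : ℝ≥0 → ℝ) ↦ (4 + (κ : ℝ))) t ω := by
    funext t ω
    rw [sleOnePointSq, sleExitTime_eq_exitTime, hint]
  rw [heq]
  exact hmart

end PosSq

/-! ### The limit `x₁ → 0+`: exit times of shrinking lower levels -/

section Limit

variable {Ω : Type*} {u : ℝ≥0 → Ω → ℝ} {ω : Ω}

/-- Coercion of a `WithTop`-minimum with a finite left argument, read back in `ℝ≥0`. [folklore] -/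
theorem untopA_min_coe_mono {t : ℝ≥0} {a b : WithTop ℝ≥0} (h : a ≤ b) :
    (min (t : WithTop ℝ≥0) a).untopA ≤ (min (t : WithTop ℝ≥0) b).untopA := by
  rw [← WithTop.coe_le_coe, coe_untopA_min, coe_untopA_min]
  exact min_le_min le_rfl h

/-- **Exit times of `(εₙ, x₂)` converge to the exit time of `(0, x₂)`**, after capping at any
time `t`, when `εₙ ↓ 0`: for a continuous path started in `(0, x₂)` above all `εₙ`, the stopped
clocks `t ∧ σₙ` increase to `t ∧ σ`. Otherwise their supremum `ℓ < t ∧ σ ≤ t` would be a finite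
limit of exit times `σₙ = t ∧ σₙ` at which the path equals `εₙ → 0` (it cannot equal `x₂`, which
would force `σ ≤ σₙ`), so the path vanishes at `ℓ`, forcing `σ ≤ ℓ`. This is the limit
`x₁ → 0+` of Lawler (2005), proof of Prop. 1.21, at the level of paths. [cite: Lawler2005, Prop. 1.21] -/
theorem tendsto_untopA_min_exitTime (hc : Continuous fun t ↦ u t ω) {x₂ : ℝ}
    (h0 : u 0 ω ∈ Ioo 0 x₂) {ε : ℕ → ℝ} (hε : Antitone ε) (hεpos : ∀ n, 0 < ε n)
    (hεlt : ∀ n, ε n < u 0 ω) (hεlim : Tendsto ε atTop (𝓝 0)) (t : ℝ≥0) :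
    Tendsto (fun n ↦ (min (t : WithTop ℝ≥0) (Process.exitTime u (ε n) x₂ ω)).untopA) atTop
      (𝓝 (min (t : WithTop ℝ≥0) (Process.exitTime u 0 x₂ ω)).untopA) := by
  set ρ : ℕ → WithTop ℝ≥0 := fun n ↦ Process.exitTime u (ε n) x₂ ω with hρdef
  set ρ₀ : WithTop ℝ≥0 := Process.exitTime u 0 x₂ ω with hρ₀def
  set v : ℕ → ℝ≥0 := fun n ↦ (min (t : WithTop ℝ≥0) (ρ n)).untopA with hvdef
  set U : ℝ≥0 := (min (t : WithTop ℝ≥0) ρ₀).untopA with hUdef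
  -- monotonicity of the exit times in the lower level
  have hanti : ∀ {a a' : ℝ}, a ≤ a' → Process.exitTime u a' x₂ ω ≤ Process.exitTime u a x₂ ω := by
    intro a a' haa'
    have := hittingAfter_anti u 0 (compl_subset_compl.2 (Ioo_subset_Ioo_left (b := x₂) haa')) ω
    simpa only [Process.exitTime_def] using this
  have hρmono : Monotone ρ := fun n m hnm ↦ hanti (hε hnm)
  have hρle : ∀ n, ρ n ≤ ρ₀ := fun n ↦ hanti (hεpos n).le
  have hvmono : Monotone v := fun n m hnm ↦ untopA_min_coe_mono (hρmono hnm)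
  have hvle : ∀ n, v n ≤ U := fun n ↦ untopA_min_coe_mono (hρle n)
  have hUt : U ≤ t := untopA_min_le t ρ₀
  have hbdd : BddAbove (range v) := ⟨U, by rintro _ ⟨n, rfl⟩; exact hvle n⟩
  have hlim : Tendsto v atTop (𝓝 (⨆ n, v n)) := tendsto_atTop_ciSup hvmono hbdd
  set ℓ := ⨆ n, v n with hℓdef
  have hℓle : ℓ ≤ U := ciSup_le hvle
  suffices hℓU : ℓ = U by rwa [hℓU] at hlim
  by_contra hne
  have hℓlt : ℓ < U := lt_of_le_of_ne hℓle hne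
  have hvn : ∀ n, v n ≤ ℓ := fun n ↦ le_ciSup hbdd n
  -- each `ρ n` is finite and equal to `v n`
  have hρeq : ∀ n, ρ n = (v n : WithTop ℝ≥0) := by
    intro n
    have hvt : v n < t := lt_of_le_of_lt (hvn n) (hℓlt.trans_le hUt)
    have h1 : min (t : WithTop ℝ≥0) (ρ n) = (v n : WithTop ℝ≥0) := (coe_untopA_min t (ρ n)).symm
    rcases le_total (t : WithTop ℝ≥0) (ρ n) with h | h
    · rw [min_eq_left h] at h1
      exact absurd (WithTop.coe_eq_coe.1 h1) hvt.ne'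
    · rw [min_eq_right h] at h1
      exact h1
  -- at `ρ n` the path is at `ε n` (the level `x₂` would force `ρ₀ ≤ ρ n`)
  have h0n : ∀ n, u 0 ω ∈ Ioo (ε n) x₂ := fun n ↦ ⟨hεlt n, h0.2⟩
  have hval : ∀ n, u (v n) ω = ε n := by
    intro n
    rcases Process.apply_eq_or_eq_of_exitTime_eq_coe hc (h0n n) (hρeq n) with h | h
    · exact h
    · exfalso
      have hmem : u (v n) ω ∈ (Ioo 0 x₂)ᶜ := by rw [h]; simp
      have hρ₀le : ρ₀ ≤ (v n : WithTop ℝ≥0) := by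
        simp only [hρ₀def, Process.exitTime_def]
        exact hittingAfter_le_of_mem zero_le hmem
      have hUle : U ≤ v n := by
        have := untopA_min_coe_mono (t := t) hρ₀le
        rwa [min_eq_right (show ((v n : ℝ≥0) : WithTop ℝ≥0) ≤ t from
          WithTop.coe_le_coe.2 ((hvn n).trans (hℓlt.le.trans hUt))), Process.untopA_coe] at this
      exact absurd ((hUle.trans (hvn n)).trans_lt hℓlt) (lt_irrefl _)
  -- hence the path vanishes at `ℓ`, forcing `ρ₀ ≤ ℓ`
  have huℓ : u ℓ ω = 0 := by
    have h1 : Tendsto (fun n ↦ u (v n) ω) atTop (𝓝 (u ℓ ω)) := (hc.tendsto ℓ).comp hlim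
    have h2 : Tendsto (fun n ↦ u (v n) ω) atTop (𝓝 0) := by
      simp only [hval]; exact hεlim
    exact tendsto_nhds_unique h1 h2
  have hρ₀le : ρ₀ ≤ (ℓ : WithTop ℝ≥0) := by
    simp only [hρ₀def, Process.exitTime_def]
    refine hittingAfter_le_of_mem zero_le ?_
    rw [mem_compl_iff, huℓ]
    simp
  have hUle : U ≤ ℓ := by
    have := untopA_min_coe_mono (t := t) hρ₀le
    rwa [min_eq_right (show ((ℓ : ℝ≥0) : WithTop ℝ≥0) ≤ t from
      WithTop.coe_le_coe.2 (hℓlt.le.trans hUt)), Process.untopA_coe] at this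
  exact absurd (hUle.trans_lt hℓlt) (lt_irrefl _)

end Limit

/-! ### The named facts -/

section Facts

/-- Stopped values of the frozen flow converge as the lower level shrinks to `0` (every path).
[cite: Lawler2005, Prop. 1.21] -/
theorem tendsto_stoppedProcess_sleRealFlowStop (hx : 0 < x) (h₂ : x < x₂) (t : ℝ≥0)
    (ω : ℝ≥0 → ℝ) :
    Tendsto (fun n : ℕ ↦ stoppedProcess (sleRealFlowStop κ x)
        (sleExitTime κ x (x / ((n : ℝ) + 2)) x₂) t ω) atTop
      (𝓝 (stoppedProcess (sleRealFlowStop κ x) (sleExitTime κ x 0 x₂) t ω)) := by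
  have hx0 : x ≠ 0 := hx.ne'
  have hc := continuous_sleRealFlowStop (κ := κ) hx0 ω
  have h0 : sleRealFlowStop κ x 0 ω ∈ Ioo 0 x₂ := by
    rw [sleRealFlowStop_zero_apply hx0]; exact ⟨hx, h₂⟩
  have hεpos : ∀ n : ℕ, 0 < x / ((n : ℝ) + 2) := fun n ↦ by positivity
  have hεlt : ∀ n : ℕ, x / ((n : ℝ) + 2) < sleRealFlowStop κ x 0 ω := by
    intro n
    rw [sleRealFlowStop_zero_apply hx0, div_lt_iff₀ (by positivity)]
    nlinarith
  have hε : Antitone fun n : ℕ ↦ x / ((n : ℝ) + 2) := fun n m hnm ↦ by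
    apply div_le_div_of_nonneg_left hx.le (by positivity)
    exact_mod_cast Nat.add_le_add_right hnm 2
  have hεlim : Tendsto (fun n : ℕ ↦ x / ((n : ℝ) + 2)) atTop (𝓝 0) := by
    have h1 : Tendsto (fun n : ℕ ↦ (n : ℝ) + 2) atTop atTop :=
      tendsto_natCast_atTop_atTop.atTop_add tendsto_const_nhds
    exact h1.const_div_atTop x |>.congr fun n ↦ rfl
  have hlim := tendsto_untopA_min_exitTime hc h0 hε hεpos hεlt hεlim t
  simp only [sleExitTime_eq_exitTime, stoppedProcess]
  exact (hc.tendsto _).comp hlim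

/-- **Lawler's power martingale, `sle_martingale_onePointPow` proved** (Lawler (2005), §1.10,
proof of Prop. 1.21, with Prop. 6.8 / eq. (6.3) for the transfer to SLE_κ): for `κ > 4` and
`0 ≤ x₁ < x < x₂`, `(X_{t∧σ})^{1-4/κ}` is a martingale of the raw Brownian filtration. For
`0 < x₁` this is Itô's formula (`martingale_sleOnePointPow_of_pos`); the level `x₁ = 0` (Lawler's
limit `x₁ → 0+`) is the bounded pointwise limit of the martingales for the levels `x/(n+2)`
(`tendsto_stoppedProcess_sleRealFlowStop`, `martingale_of_tendsto_of_abs_le'`).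
[cite: Lawler2005, Prop. 1.21] -/
theorem sle_martingale_onePointPow_holds : sle_martingale_onePointPow := by
  intro κ hκ x x₁ x₂ hx₁ h₁ h₂
  rcases hx₁.eq_or_lt with h0 | hx₁pos
  · subst h0
    haveI := isProbabilityMeasure_preWienerMeasure'
    have hx : 0 < x := h₁
    have hκ4 : (4 : ℝ) < κ := by exact_mod_cast hκ
    set q : ℝ := 1 - 4 / (κ : ℝ) with hqdef
    have hq : 0 ≤ q := by
      rw [hqdef, sub_nonneg, div_le_one (by linarith)]; exact hκ4.le
    have hεpos : ∀ n : ℕ, 0 < x / ((n : ℝ) + 2) := fun n ↦ by positivity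
    have hεlt : ∀ n : ℕ, x / ((n : ℝ) + 2) < x := fun n ↦ by
      rw [div_lt_iff₀ (by positivity)]; nlinarith
    have hM : ∀ n : ℕ, Martingale (sleOnePointPow κ x (x / ((n : ℝ) + 2)) x₂) brownianFiltration
        preWienerMeasure := fun n ↦ martingale_sleOnePointPow_of_pos hκ (hεpos n) (hεlt n) h₂
    refine martingale_of_tendsto_of_abs_le' hM (C := fun _ ↦ x₂ ^ q) (fun n t ω ↦ ?_)
      (fun t ω ↦ ?_)
    · have hmem := stoppedProcess_sleRealFlowStop_exitTime_mem_Icc (κ := κ) hx.ne' (hεlt n) h₂ t ω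
      rw [sleOnePointPow, sleExitTime_eq_exitTime]
      have h0 : 0 ≤ stoppedProcess (sleRealFlowStop κ x)
          (Process.exitTime (sleRealFlowStop κ x) (x / ((n : ℝ) + 2)) x₂) t ω :=
        (hεpos n).le.trans hmem.1
      rw [abs_of_nonneg (Real.rpow_nonneg h0 _)]
      exact Real.rpow_le_rpow h0 hmem.2 hq
    · simp only [sleOnePointPow]
      exact (tendsto_stoppedProcess_sleRealFlowStop hx h₂ t ω).rpow_const (Or.inr hq)
  · exact martingale_sleOnePointPow_of_pos hκ hx₁pos h₁ h₂

/-- **The quadratic one-point martingale, `sle_martingale_onePointSq` proved**: for `κ > 0` and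
`0 ≤ x₁ < x < x₂`, `(X_{t∧σ})² - (4+κ)(t∧σ)` is a martingale of the raw Brownian filtration
(Itô's formula for `u²` for `0 < x₁`, `martingale_sleOnePointSq_of_pos`; bounded pointwise limit of
the levels `x/(n+2)` for `x₁ = 0`, with the bound `x₂² + (4+κ)t` at time `t`).
Revuz–Yor (1999), Ch. XI §1; Lawler (2005), eq. (6.3), proof of Prop. 1.21.
[cite: RevuzYor1999, Ch. XI §1 Def. (1.1)] -/
theorem sle_martingale_onePointSq_holds : sle_martingale_onePointSq := by
  intro κ _ x x₁ x₂ hx₁ h₁ h₂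
  rcases hx₁.eq_or_lt with h0 | hx₁pos
  · subst h0
    haveI := isProbabilityMeasure_preWienerMeasure'
    have hx : 0 < x := h₁
    have hεpos : ∀ n : ℕ, 0 < x / ((n : ℝ) + 2) := fun n ↦ by positivity
    have hεlt : ∀ n : ℕ, x / ((n : ℝ) + 2) < x := fun n ↦ by
      rw [div_lt_iff₀ (by positivity)]; nlinarith
    have hM : ∀ n : ℕ, Martingale (sleOnePointSq κ x (x / ((n : ℝ) + 2)) x₂) brownianFiltration
        preWienerMeasure := fun n ↦ martingale_sleOnePointSq_of_pos (hεpos n) (hεlt n) h₂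
    refine martingale_of_tendsto_of_abs_le' hM (C := fun t ↦ x₂ ^ 2 + (4 + (κ : ℝ)) * t)
      (fun n t ω ↦ ?_) (fun t ω ↦ ?_)
    · have hmem := stoppedProcess_sleRealFlowStop_exitTime_mem_Icc (κ := κ) hx.ne' (hεlt n) h₂ t ω
      rw [sleOnePointSq, sleExitTime_eq_exitTime]
      set v := stoppedProcess (sleRealFlowStop κ x)
        (Process.exitTime (sleRealFlowStop κ x) (x / ((n : ℝ) + 2)) x₂) t ω with hv
      set s : ℝ≥0 := (min (t : WithTop ℝ≥0)
        (Process.exitTime (sleRealFlowStop κ x) (x / ((n : ℝ) + 2)) x₂ ω)).untopA with hs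
      have hst : (s : ℝ) ≤ t := NNReal.coe_le_coe.2 (untopA_min_le t _)
      have hv0 : 0 ≤ v := (hεpos n).le.trans hmem.1
      have hv2 : v ^ 2 ≤ x₂ ^ 2 := pow_le_pow_left₀ hv0 hmem.2 2
      have hκ0 : (0 : ℝ) ≤ 4 + κ := by positivity
      rw [abs_le]
      constructor
      · nlinarith [mul_le_mul_of_nonneg_left hst hκ0, sq_nonneg v, s.coe_nonneg]
      · nlinarith [mul_le_mul_of_nonneg_left hst hκ0, s.coe_nonneg]
    · simp only [sleOnePointSq]
      refine ((tendsto_stoppedProcess_sleRealFlowStop hx h₂ t ω).pow 2).sub ?_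
      refine tendsto_const_nhds.mul ?_
      have hx0 : x ≠ 0 := hx.ne'
      have hc := continuous_sleRealFlowStop (κ := κ) hx0 ω
      have h0 : sleRealFlowStop κ x 0 ω ∈ Ioo 0 x₂ := by
        rw [sleRealFlowStop_zero_apply hx0]; exact ⟨hx, h₂⟩
      have hεlt' : ∀ n : ℕ, x / ((n : ℝ) + 2) < sleRealFlowStop κ x 0 ω := by
        intro n; rw [sleRealFlowStop_zero_apply hx0]; exact hεlt n
      have hε : Antitone fun n : ℕ ↦ x / ((n : ℝ) + 2) := fun n m hnm ↦ by
        apply div_le_div_of_nonneg_left hx.le (by positivity)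
        exact_mod_cast Nat.add_le_add_right hnm 2
      have hεlim : Tendsto (fun n : ℕ ↦ x / ((n : ℝ) + 2)) atTop (𝓝 0) := by
        have h1 : Tendsto (fun n : ℕ ↦ (n : ℝ) + 2) atTop atTop :=
          tendsto_natCast_atTop_atTop.atTop_add tendsto_const_nhds
        exact h1.const_div_atTop x |>.congr fun n ↦ rfl
      have hlim := tendsto_untopA_min_exitTime hc h0 hε hεpos hεlt' hεlim t
      simp only [sleExitTime_eq_exitTime]
      exact (NNReal.continuous_coe.tendsto _).comp hlim
  · exact martingale_sleOnePointSq_of_pos hx₁pos h₁ h₂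

end Facts

end Literature.Probability.RandomPlanarGeometry
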